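import Literature.NumberTheory.EllipticCurves.HeegnerPointsKolyvaginPrimaryClassesProofs
import HarnessLib

/-!
# Route `GenusKolyvaginAtTwo`, crux L_T `PowDvdShaCardAtTwoRT` (stmt-BirchSwinnertonDyer-23242), LINE 18/19 stub 3a⁗, step (b):
# the VALUES of a Kolyvagin class at an OWN prime lie in a LINE (the input of the `K_λ` isotropy criterion)

Seat `bsd-line-gk2-p3` g19 (cell `bsd-f1-sign2`), `--supports 23242 --as helper`. Abstract `KolyvaginCocycle` shell (McCallum's cocycle
`g ↦ gQ − Q − (g−1)P/n` of `HeegnerPointsKolyvaginPrimaryClassesProofs`); THEOREMS ONLY. BSD is not proved by any of this; neither is the crux.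

McCallum 1991, proof of Prop. 4.4 (p. 305): at the prime `λ ∣ n` (inert in `K`, totally ramified in `K_n/K_{n/ℓ}`, split completely in
`K(E[p^M])`) the cocycle of `c_M(n)` restricted to the decomposition group «vanishes when restricted to `K_{λ_n}` [because
`P_n ∈ p^M E(K_{λ_n})`: `D_ℓ = ℓ(ℓ+1)/2` on the residue field] and factors through `Gal(K_{λ_n}/K_λ) = ⟨σ_ℓ⟩`». Over `K_λ` the
decomposition group fixes `E[n]`, so the restricted cocycle is a HOMOMORPHISM, and a homomorphism factoring through a cyclic group takes
all its values in the LINE generated by its value at a generator. This file records exactly that, with the two arithmetic facts as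
displayed hypotheses: `hcyc` (the decomposition group `D` acts on `P = P_n` through the cyclic group generated by `τ₁`, a lift of `σ_ℓ`)
and `hQ` (an `n`-th root `Q` of `P` fixed by every element of `D` fixing `P` — i.e. `P_n` is `n`-divisible in `E(K_{n,λ_n})`; at `p = 2`
this wants primes of index `≥ M+1`, the «`ℓ(ℓ+1)/2`» bit, as the LINE 6 files already arrange).

* `h1Eval_kolyvaginClass_eq_zero_of_smul_eq` — `ν ∈ Γ_{K(E[n])}`, `νP = P`, `νQ = Q` ⟹ `[c(P), ν] = 0`.
* `h1Eval_kolyvaginClass_pow_eq` — `[c(P), τ₁^j] = j·[c(P), τ₁]` for `τ₁ ∈ Γ_{K(E[n])}`.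
* **`exists_h1Eval_kolyvaginClass_eq_zsmul`** — for `D ≤ Γ_{K(E[n])}` with `hcyc`, `hQ`: every value `[c(P), τ]`, `τ ∈ D`, is a
  multiple of `[c(P), τ₁]`; and `exists_h1Eval_kolyvaginClass_eq_zsmul_of_mem_zmultiples` — if `[c(P), τ₁] ∈ ℤ ℓ₀` then all values
  lie in `ℤ ℓ₀` (the hypothesis shape `hxF`/`hxI` of `…RTTransverseIsotropicValues.cupProduct_localization_eq_zero_of_values_in_line`
  with `D = G_𝔓 ⊇ I_𝔓 ∋ F`).

So: two Kolyvagin classes at a common own prime whose generator values `[c, τ₁]`, `[c′, τ₁]` lie in one `e`-isotropic line (same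
`E`-sign: the anti-fixed or the fixed line of the regular module, LEAD's `…RTEigenNorms`) have vanishing local cup product — the own-prime
terms of McCallum's (13) over the Heegner field.

References: [McCallumLMS1991] §4 Lemma 4.1, Prop. 4.4 (proof, p. 305), §5 Lemma 5.3; [GrossLMS1991] §4 (4.6), Prop. 6.2 (2).
-/

set_option autoImplicit false
set_option linter.dupNamespace false -- tree convention: `Summit.BirchSwinnertonDyer.BirchSwinnertonDyer.Theorems` (summit = sub-problem)

noncomputable section
open scoped Classical Pointwise
universe u

namespace Summit.BirchSwinnertonDyer.BirchSwinnertonDyer.Theorems.GenusExact.TransverseIsotropy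

open WeierstrassCurve Field
open Literature.NumberTheory.EllipticCurves Literature.NumberTheory.GaloisRepresentations
open Literature.NumberTheory.EllipticCurves.KolyvaginCocycle

variable {K : Type u} [Field K] (W : WeierstrassCurve K) {n : ℤ}
  {hdiv : ∀ P : geomPoints W, ∃ Q : geomPoints W, n • Q = P} {A : AddSubgroup (geomPoints W)}

/-- **The value of Kolyvagin's class at an element fixing `E[n]`, `P` and the root `Q`** is `0`: `[c(P), ν] = νQ − Q − (ν−1)P/n = 0`.
[cite: McCallumLMS1991, Lemma 4.1] -/
theorem h1Eval_kolyvaginClass_eq_zero_of_smul_eq (hA : IsAdmissible (absoluteGaloisGroup K) A n)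
    {P : geomPoints W} (hP : P ∈ invPoints (absoluteGaloisGroup K) A n) {Q : geomPoints W} (hQ : n • Q = P)
    {ν : absoluteGaloisGroup K} (hν : ν ∈ torsionFixing W n) (hνP : ν • P = P) (hνQ : ν • Q = Q) :
    h1Eval W n (kolyvaginClass W n hdiv hA P hP) ν = 0 := by
  rw [kolyvaginClass_eq_cls hA hP hQ]
  unfold KolyvaginCocycle.cls
  rw [h1Eval_oneCocycleClass W n _ hν]
  apply Subtype.ext
  rw [coe_cocycle_apply, hνQ, hνP, sub_self, sub_self, rootIn_zero hA.eq_zero_of_zsmul, sub_zero]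
  rfl

/-- **`[c(P), τ₁^j] = j·[c(P), τ₁]`** for `τ₁` fixing `E[n]` (the restricted cocycle is a homomorphism). [folklore] -/
theorem h1Eval_kolyvaginClass_pow_eq (hA : IsAdmissible (absoluteGaloisGroup K) A n)
    {P : geomPoints W} (hP : P ∈ invPoints (absoluteGaloisGroup K) A n)
    {τ₁ : absoluteGaloisGroup K} (hτ₁ : τ₁ ∈ torsionFixing W n) (j : ℕ) :
    h1Eval W n (kolyvaginClass W n hdiv hA P hP) (τ₁ ^ j) = (j : ℤ) • h1Eval W n (kolyvaginClass W n hdiv hA P hP) τ₁ := by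
  induction j with
  | zero => rw [pow_zero, h1Eval_one, Nat.cast_zero, zero_smul]
  | succ j ih =>
    rw [pow_succ, h1Eval_mul W n _ (Subgroup.pow_mem _ hτ₁ j), ih, Nat.cast_succ, add_smul, one_smul]

/-- **The values of a Kolyvagin class on a subgroup acting through a cyclic group lie in a line.** `D ≤ Γ_{K(E[n])}` (at an own prime
`λ ∣ n` over the Heegner field: the decomposition group, `λ` splitting completely in `K(E[n])`); `D` acts on `P` through the cyclic group
generated by `τ₁ ∈ D` (`hcyc`: every `τ ∈ D` is `τ₁^j ν` with `ν ∈ D` fixing `P` — the image of `D_λ` in `Gal(K_n/K)` is `⟨σ_ℓ⟩`); `Q` an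
`n`-th root of `P` fixed by the elements of `D` fixing `P` (`P_n ∈ nE(K_{n,λ_n})`). Then every `[c(P), τ]`, `τ ∈ D`, is a multiple of
`[c(P), τ₁]` (McCallum: the restricted cocycle «factors through `Gal(K_{λ_n}/K_λ) = ⟨σ_ℓ⟩`»). [cite: McCallumLMS1991, Prop. 4.4 (proof, p. 305)] -/
theorem exists_h1Eval_kolyvaginClass_eq_zsmul (hA : IsAdmissible (absoluteGaloisGroup K) A n)
    {P : geomPoints W} (hP : P ∈ invPoints (absoluteGaloisGroup K) A n) {Q : geomPoints W} (hQn : n • Q = P)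
    {D : Subgroup (absoluteGaloisGroup K)} (hD : D ≤ torsionFixing W n) {τ₁ : absoluteGaloisGroup K} (hτ₁ : τ₁ ∈ D)
    (hcyc : ∀ τ ∈ D, ∃ (j : ℕ) (ν : absoluteGaloisGroup K), ν ∈ D ∧ ν • P = P ∧ τ = τ₁ ^ j * ν)
    (hQ : ∀ ν ∈ D, ν • P = P → ν • Q = Q) :
    ∀ τ ∈ D, ∃ k : ℤ,
      h1Eval W n (kolyvaginClass W n hdiv hA P hP) τ = k • h1Eval W n (kolyvaginClass W n hdiv hA P hP) τ₁ := by
  intro τ hτ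
  obtain ⟨j, ν, hνD, hνP, rfl⟩ := hcyc τ hτ
  refine ⟨j, ?_⟩
  rw [h1Eval_mul W n _ (Subgroup.pow_mem _ (hD hτ₁) j), h1Eval_kolyvaginClass_pow_eq W hA hP (hD hτ₁),
    h1Eval_kolyvaginClass_eq_zero_of_smul_eq W hA hP hQn (hD hνD) hνP (hQ ν hνD hνP), add_zero]

/-- The same with the line prescribed: if the generator value `[c(P), τ₁]` lies in `ℤ ℓ₀`, all values `[c(P), τ]`, `τ ∈ D`, lie in
`ℤ ℓ₀` — the hypotheses `hxF` (`F ∈ D`) and `hxI` (`I_𝔓 ≤ D`) of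
`…RTTransverseIsotropicValues.cupProduct_localization_eq_zero_of_values_in_line`. [cite: McCallumLMS1991, Prop. 4.4 (proof, p. 305), §5 Lemma 5.3] -/
theorem exists_h1Eval_kolyvaginClass_eq_zsmul_of_mem_zmultiples (hA : IsAdmissible (absoluteGaloisGroup K) A n)
    {P : geomPoints W} (hP : P ∈ invPoints (absoluteGaloisGroup K) A n) {Q : geomPoints W} (hQn : n • Q = P)
    {D : Subgroup (absoluteGaloisGroup K)} (hD : D ≤ torsionFixing W n) {τ₁ : absoluteGaloisGroup K} (hτ₁ : τ₁ ∈ D)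
    (hcyc : ∀ τ ∈ D, ∃ (j : ℕ) (ν : absoluteGaloisGroup K), ν ∈ D ∧ ν • P = P ∧ τ = τ₁ ^ j * ν)
    (hQ : ∀ ν ∈ D, ν • P = P → ν • Q = Q) {ℓ₀ : geomTorsion W n}
    (hℓ₀ : ∃ k₁ : ℤ, h1Eval W n (kolyvaginClass W n hdiv hA P hP) τ₁ = k₁ • ℓ₀) :
    ∀ τ ∈ D, ∃ k : ℤ, h1Eval W n (kolyvaginClass W n hdiv hA P hP) τ = k • ℓ₀ := by
  intro τ hτ
  obtain ⟨k, hk⟩ := exists_h1Eval_kolyvaginClass_eq_zsmul W hA hP hQn hD hτ₁ hcyc hQ τ hτ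
  obtain ⟨k₁, hk₁⟩ := hℓ₀
  exact ⟨k * k₁, by rw [hk, hk₁, smul_smul]⟩

end Summit.BirchSwinnertonDyer.BirchSwinnertonDyer.Theorems.GenusExact.TransverseIsotropy

end
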